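import Summits.QuantumFields.YangMills.Theorems.TwistedTraceScaling.Negative.ValleyOrbitDistPolyakovFloor
import Summits.QuantumFields.YangMills.Theorems.TwistedTraceScaling.Negative.OneSiteGainWindow
import Summits.QuantumFields.YangMills.Theorems.LuscherReductionTwistedTraceScalingInnerTwoZone
import Summits.QuantumFields.YangMills.Theorems.LuscherReductionTwistedTraceScalingToronCurl
import Summits.QuantumFields.YangMills.Theorems.LuscherReductionTwistedTraceScalingAxisRotation
import Summits.QuantumFields.YangMills.Theorems.FemtoTransferGapZeroModes
import HarnessLib

/-!
# Negative lemma R24b (crux `TwistedTraceScaling`, stmt-QuantumFields-20203): at the record exponents of lane A's C4-SHELL architecture (core radius `β^{−1/5}`,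
# one-site threshold `t ≥ B^{−1/5}`, `B = L³β`) the innermost shell contains valley configurations whose one-site image lies BELOW the one-site theorem's
# threshold — for EVERY `L ≥ 2` and EVERY `β ≥ 1`; and the stiff-layer exponent a pointwise cell comparison needs

Standing disprover `ym-cdisprove-20203-1` (gen 19), part 2 of 2 (part 1: `…Negative.ValleyOrbitDistPolyakovFloor`, the Polyakov floor and `orbitDist(V_θ) ≍ L³Σ|θ_k|`),
vetting the typed C4-SHELL texts of lane A (ym-luscher-20007-p1 g11): the target `InnerShellGainSmallAt L (powScale (1/5)) (powScale (1/40)) (powScale (17/20))`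
(`…InnerTwoZone` §SmallAction), the one-site shell gain `…OneSiteShellGainPrelim` + `…OneSiteShellGain.oneSite_shell_gain` (p611472: `∃ B₀, ∀ B ≥ B₀, ∀ t`,
`B^{−1/5} ≤ t ≤ 1/5000`, `f = 0` on `{‖zmCoord 1 U‖ < t}` ⇒ `qform su2Rep B f f ≤ linkCE B·(1 − t√t/40)·l2 f f`),
and COARSE-DESIGN §22.6 (cells; L³-site reduction «orbitDist-shell `t` ↦ one-site radius `t`»).  Kernel-checked content:
* §3 ★★ **shell witness**: the one-axis valley configuration `V* = V_{(T,0,0)}`, `T = π·β^{−s}/(2√2·L³)`: `S(V*) = 0`, `β^{−s} ≤ orbitDist V* ≤ (π/2)·β^{−s}` (every `β`),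
  and eventually `orbitDist V* < β^{−q}` (`q < s`), `β^{−s}/2 < orbitDist(τ_z V*)` for EVERY twist `z` (disjointness of the eight inner neighbourhoods of radius `1/L`):
  `V*` lies in the support region of `InnerShellGainSmallAt L (β^{−s}) (β^{−q}) (β^{−e})` (`record_shell_witness_mem_region`; record `(s,q,e) = (1/5,1/40,17/20)`); its links are
  within `(π/2)·β^{−s}/L³` of `1` and its one-site image `abelianCfg 1 (T,0,0)` has `‖zmCoord 1 ·‖ = |sin T| ≤ T` (`norm_zmCoord_oneSite_image`).
* §4 ★★ **verdict at equal exponents**: for `1/5 ≤ s`, EVERY `L ≥ 2`, EVERY `β ≥ 1`: `T < (L³β)^{−1/5}` and `‖zmCoord 1 (one-site image)‖ < (L³β)^{−1/5}`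
  (`witness_radius_lt_threshold`, `witness_oneSite_radius_lt_threshold`; the comparison is the β-free `π/(2√2) < (L³)^{4/5}`): at the record pair (core `s = 1/5`, threshold
  exponent `1/5`) the innermost factor `≈ (2√2/π)·L^{12/5} ≥ 4.7` of the shell (2–5 dyadic cells) is covered by NO admissible `t` of the one-site theorem, uniformly in `β`;
  `s < 1/5` strictly clears it eventually (`threshold_le_witness_radius_eventually`); β-free form `threshold_le_iff_const`.  This SHARPENS R23 §4
  (`record_radius_lt_oneSite_threshold`, "`L ≤ 3`"), which compared `orbitDist` units with `zmCoord` units: in consistent units (factor `L³`, part 1) the obstruction is every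
  `L ≥ 2`.  §22.6(c)'s «`t ≥ β^{−1/5}`-ish `≥ B^{−1/5}` ✓» reads, in one-site units, `(π/(2√2))·β^{−1/5}/L³ ≥ L^{−3/5}β^{−1/5}` — false for `L ≥ 2`.
  Repairs (any one): core exponent `s < 1/5` strictly (`3/16`, `4/21`; the R22/R23 windows `1/6 < s < 2/9` are unaffected); or the one-site threshold `B^{−a}`, `a ∈ (1/5, 1/4)`
  (Prelim's binding constraint is `t ≥ 100·B^{−1/4}`); or the threshold constant freed, `t ≥ c·B^{−1/5}` with `c ≤ 0.55·L^{−12/5}`.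
* §5 **pointwise cell comparison — the stiff-layer exponent**: a frozen-Gaussian cell of power-law radius `r = β^{−ρ}` needs the IMS cost `(βr²)^{−1} = β^{−(1−2ρ)}` AND the
  first-order slow–stiff coupling cost `β·r·|w|² ≤ β^{−(ρ+q−1)}` on the stiff layer `|w|² ≤ β^{−q}` below the gain `β^{−3s/2}`; such a `ρ` exists iff `s < (4q − 2)/9`
  (`cell_pointwise_exponents_iff`, `cell_costs_eventually_iff`): on the small-action layer of record (`q = 17/20`) the window is `s < 7/45 < 1/6` — EMPTY against the core
  condition `s > 1/6` (R23); it meets the core window iff `q > 7/8`, and reaches the record core `s = 1/5` iff `q > 19/20`; the Gaussian layer `q = 1` restores `s < 2/9`.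
  So «pointwise on the small-action bulk `|w| ≲ β^{−0.42}`» (§22.6(c)) is misstated as a region: the comparison must be run on a stiff layer `|w|² ≤ β^{−q}`, `q > 7/8`
  (its own admissibility/Boltzmann bookkeeping to be shown), or the first-order coupling absorbed exactly (frozen weight `Ω_c` at the determinant level, as §22.6(a) hints).

HONEST FRAMING: negative/tightness bookkeeping about the SHELL brick of stub S-BASE (C4) of a child of the CONDITIONAL reduction route R2b1 (rank 202); nothing here is
`¬TwistedTraceScaling`, nothing is a gap, nothing is Clay.  Not Mathlib material: project-specific bookkeeping.
-/

set_option autoImplicit false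

noncomputable section

open Real Finset
open scoped Matrix ComplexConjugate BigOperators
open Literature.MathematicalPhysics.QuantumFieldTheory hiding SU2
open Literature.MathematicalPhysics.QuantumLattice
open Summit.QuantumFields.YangMills.Theorems.FemtoTransferGap
open Summit.QuantumFields.YangMills.Theorems.FemtoTransferGap.TwoLattice.Toron
open Summit.QuantumFields.YangMills.Theorems.FemtoTransferGap.TwoLattice.Flat

namespace Summit.QuantumFields.YangMills.Theorems.TwistedTraceScaling.Negative.R24

variable {L : ℕ}

/-! ## §3 The shell witness `V* = V_{(T,0,0)}`, `T = π·β^{−s}/(2√2·L³)` -/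

section Witness

/-- `Σ_k |(T,0,0)_k| = |T|`. [folklore] -/
theorem sum_abs_axis (T : ℝ) : ∑ k : Fin 3, |(if k = (0 : Fin 3) then T else 0)| = |T| := by
  simp [Fin.sum_univ_three]

/-- The witness angle is positive. [folklore] -/
theorem axisAngle_pos [NeZero L] (s β : ℝ) : 0 < Real.pi * powScale s β / (2 * Real.sqrt 2 * (L : ℝ) ^ 3) := by
  have hL : (0 : ℝ) < L := by exact_mod_cast Nat.pos_of_ne_zero (NeZero.ne L)
  have := powScale_pos s β
  positivity

/-- The witness angle is at most `π/L` (indeed `≤ π/(2√2 L³)`), so the linear floor applies. [folklore] -/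
theorem axisAngle_le [NeZero L] {s : ℝ} (hs : 0 ≤ s) (β : ℝ) : Real.pi * powScale s β / (2 * Real.sqrt 2 * (L : ℝ) ^ 3) ≤ Real.pi / L := by
  have hL : (0 : ℝ) < L := by exact_mod_cast Nat.pos_of_ne_zero (NeZero.ne L)
  have hL1 : (1 : ℝ) ≤ L := by exact_mod_cast Nat.one_le_iff_ne_zero.mpr (NeZero.ne L)
  have hp := powScale_le_one hs β
  have hp0 := powScale_pos s β
  have h2 : (1 : ℝ) ≤ Real.sqrt 2 := by
    have h := Real.sqrt_le_sqrt (show (1 : ℝ) ≤ 2 by norm_num)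
    rwa [Real.sqrt_one] at h
  rw [div_le_div_iff₀ (by positivity) hL]
  have hL3pos : (0 : ℝ) ≤ (L : ℝ) ^ 3 := by positivity
  have hL3 : (L : ℝ) ≤ (L : ℝ) ^ 3 := by
    calc (L : ℝ) = L * 1 * 1 := by ring
      _ ≤ L * L * L := by gcongr
      _ = (L : ℝ) ^ 3 := by ring
  have e1 : powScale s β * L ≤ L := by nlinarith
  have e2 : (L : ℝ) ^ 3 ≤ 2 * Real.sqrt 2 * (L : ℝ) ^ 3 := by nlinarith
  have e3 : powScale s β * L ≤ 2 * Real.sqrt 2 * (L : ℝ) ^ 3 := by linarith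
  have e4 := mul_le_mul_of_nonneg_left e3 Real.pi_pos.le
  linarith

/-- ★ **Size of the witness**: `β^{−s} ≤ orbitDist V* ≤ (π/2)·β^{−s}` for every `β` (`0 ≤ s`). [cite: Luscher1983, §2] -/
theorem orbitDist_witness_bounds [NeZero L] {s : ℝ} (hs : 0 ≤ s) (β : ℝ) :
    powScale s β ≤ orbitDist (abelianCfg L fun k => if k = (0 : Fin 3) then Real.pi * powScale s β / (2 * Real.sqrt 2 * (L : ℝ) ^ 3) else 0) ∧
      orbitDist (abelianCfg L fun k => if k = (0 : Fin 3) then Real.pi * powScale s β / (2 * Real.sqrt 2 * (L : ℝ) ^ 3) else 0) ≤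
        Real.pi / 2 * powScale s β := by
  have hL : (0 : ℝ) < L := by exact_mod_cast Nat.pos_of_ne_zero (NeZero.ne L)
  have hT0 := axisAngle_pos (L := L) s β
  have hTle := axisAngle_le (L := L) hs β
  set T := Real.pi * powScale s β / (2 * Real.sqrt 2 * (L : ℝ) ^ 3) with hT
  have hθ : ∀ k : Fin 3, |(if k = (0 : Fin 3) then T else 0)| ≤ Real.pi / L := by
    intro k
    split_ifs
    · rw [abs_of_pos hT0]; exact hTle
    · rw [abs_zero]; positivity
  obtain ⟨hlo, hhi⟩ := orbitDist_abelianCfg_two_sided hθ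
  rw [sum_abs_axis, abs_of_pos hT0] at hlo hhi
  have h2 : (0 : ℝ) < Real.sqrt 2 := by positivity
  have hπ : 0 < Real.pi := Real.pi_pos
  constructor
  · calc powScale s β = 2 * Real.sqrt 2 / Real.pi * (L : ℝ) ^ 3 * T := by rw [hT]; field_simp
      _ ≤ _ := hlo
  · calc _ ≤ Real.sqrt 2 * (L : ℝ) ^ 3 * T := hhi
      _ = Real.pi / 2 * powScale s β := by rw [hT]; field_simp

/-- `S(V*) = 0 < 2η(β)` for every positive threshold scale. [cite: Luscher1983, §2] -/
theorem wilsonAction_witness_lt [NeZero L] (θ : Fin 3 → ℝ) (q β : ℝ) : wilsonAction su2Rep (abelianCfg L θ) < 2 * powScale q β := by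
  rw [wilsonAction_abelianCfg]
  have := powScale_pos q β
  linarith

/-- ★★ **The witness lies in the support region of `InnerShellGainSmallAt L (β^{−s}) (β^{−q}) (β^{−e})`** (`0 ≤ q < s`, any `e`; record `(s, q, e) = (1/5, 1/40, 17/20)`):
eventually in `β`, `S(V*) < 2β^{−e}`, `orbitDist(τ_z V*) < β^{−q}` for the trivial twist, and `β^{−s}/2 < orbitDist(τ_z V*)` for EVERY twist `z` (the trivial one by the
floor; the seven non-trivial ones by the disjointness of the inner neighbourhoods of radius `1/L`). [cite: Luscher1983, §2] [cite: tHooft1979] -/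
theorem record_shell_witness_mem_region [NeZero L] {s q : ℝ} (hq : 0 ≤ q) (hqs : q < s) (e : ℝ) :
    ∃ β0 : ℝ, ∀ β : ℝ, β0 ≤ β →
      wilsonAction su2Rep (abelianCfg L fun k => if k = (0 : Fin 3) then Real.pi * powScale s β / (2 * Real.sqrt 2 * (L : ℝ) ^ 3) else 0) <
          2 * powScale e β ∧
        (∃ z : Fin 3 → Bool, orbitDist (TT.twist3 z
          (abelianCfg L fun k => if k = (0 : Fin 3) then Real.pi * powScale s β / (2 * Real.sqrt 2 * (L : ℝ) ^ 3) else 0)) < powScale q β) ∧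
        ∀ z : Fin 3 → Bool, powScale s β / 2 < orbitDist (TT.twist3 z
          (abelianCfg L fun k => if k = (0 : Fin 3) then Real.pi * powScale s β / (2 * Real.sqrt 2 * (L : ℝ) ^ 3) else 0)) := by
  have hL : (0 : ℝ) < L := by exact_mod_cast Nat.pos_of_ne_zero (NeZero.ne L)
  have hs : 0 ≤ s := hq.trans hqs.le
  -- eventually `(π/2)·β^{−s} < β^{−q}` and `(π/2)·β^{−s} < 1/L`
  obtain ⟨β1, h1⟩ := R23.mul_powScale_le_eventually (a := s) (b := q) hqs Real.pi (D := 1) one_pos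
  obtain ⟨β2, h2⟩ := R23.mul_powScale_le_eventually (a := s) (b := 0) (hq.trans_lt hqs) Real.pi (D := 1 / L) (by positivity)
  refine ⟨max β1 β2, fun β hβ => ?_⟩
  have hb1 : β1 ≤ β := le_trans (le_max_left _ _) hβ
  have hb2 : β2 ≤ β := le_trans (le_max_right _ _) hβ
  obtain ⟨hlo, hhi⟩ := orbitDist_witness_bounds (L := L) hs β
  set V := abelianCfg L fun k => if k = (0 : Fin 3) then Real.pi * powScale s β / (2 * Real.sqrt 2 * (L : ℝ) ^ 3) else 0 with hV
  have hp := powScale_pos s β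
  have hπp : powScale s β < Real.pi * powScale s β := by nlinarith [Real.pi_gt_three]
  have hp0 : powScale 0 β = 1 := by simp [powScale]
  have h2' : Real.pi * powScale s β ≤ 1 / L := by
    have h := h2 β hb2
    rwa [hp0, mul_one] at h
  have hsmall : orbitDist V < 1 / L := by linarith
  refine ⟨wilsonAction_witness_lt _ e β, ⟨fun _ => false, ?_⟩, fun z => ?_⟩
  · rw [TT.twist3_false]
    have h := h1 β hb1
    linarith
  · by_cases hz : z = fun _ => false
    · rw [hz, TT.twist3_false]; linarith
    · by_contra hle
      push Not at hle
      have hzr : orbitDist (TT.twist3 z V) < 1 / L := by linarith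
      have hLr : (L : ℝ) * (1 / L) < 2 := by rw [mul_one_div_cancel hL.ne']; norm_num
      exact hz (twist3_trivial_of_orbitDist_lt hLr hsmall hzr)

/-- Every link of `V*` is within `√2·T = (π/2)·β^{−s}/L³` of `1` (Frobenius). [folklore] -/
theorem frobNorm_witness_link_le [NeZero L] (s β : ℝ) (e : Edge 3 L) :
    frobNorm ((((abelianCfg L fun k => if k = (0 : Fin 3) then Real.pi * powScale s β / (2 * Real.sqrt 2 * (L : ℝ) ^ 3) else 0) e : SU2) :
        Matrix (Fin 2) (Fin 2) ℂ) - 1) ≤ Real.pi / 2 * powScale s β / (L : ℝ) ^ 3 := by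
  have hL : (0 : ℝ) < L := by exact_mod_cast Nat.pos_of_ne_zero (NeZero.ne L)
  have hT0 := axisAngle_pos (L := L) s β
  have h2 : (0 : ℝ) < Real.sqrt 2 := by positivity
  rw [abelianCfg_apply]
  refine (frobNorm_diagSU2_sub_one_le _).trans ?_
  split_ifs
  · rw [abs_of_pos hT0]
    apply le_of_eq
    have hc : (2 * Real.sqrt 2 * (L : ℝ) ^ 3) ≠ 0 := by positivity
    have hL3 : ((L : ℝ) ^ 3) ≠ 0 := by positivity
    rw [mul_div_assoc', div_eq_div_iff hc hL3]
    ring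
  · rw [abs_zero, mul_zero]
    have := powScale_pos s β
    positivity

/-- ★ **One-site image of the witness**: the single-site configuration with the same links, `abelianCfg 1 (T,0,0)`, has zero-mode radius `‖zmCoord 1 ·‖ = |sin T|`
(`≤ T`). [cite: Luscher1983, §2] [cite: Vanbaal2001, §4] -/
theorem norm_zmCoord_oneSite_image (T : ℝ) : ‖zmCoord 1 (abelianCfg 1 fun k => if k = (0 : Fin 3) then T else 0)‖ = |Real.sin T| := by
  rw [EuclideanSpace.norm_eq, Fintype.sum_prod_type]
  simp [abelianCfg, edgeOf, vecPart_diagSU2, Fin.sum_univ_three, Real.sqrt_sq_eq_abs]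

/-- Hence the one-site radius of the witness is at most `T`. [folklore] -/
theorem norm_zmCoord_oneSite_image_le {T : ℝ} (hT : 0 ≤ T) : ‖zmCoord 1 (abelianCfg 1 fun k => if k = (0 : Fin 3) then T else 0)‖ ≤ T := by
  rw [norm_zmCoord_oneSite_image]
  exact Real.abs_sin_le_abs.trans (abs_of_nonneg hT).le

end Witness

/-! ## §4 Verdict at equal exponents: the witness radius versus the one-site threshold `(L³β)^{−1/5}` -/

section Threshold

/-- The β-free comparison: `π/(2√2·L³) < (L³)^{−1/5}` for every `L ≥ 2` (`π/(2√2) < 2 ≤ (3/2)⁴ < (L³)^{4/5}`). [folklore] -/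
theorem axis_const_lt_threshold_const {L : ℕ} (hL : 2 ≤ L) : Real.pi / (2 * Real.sqrt 2 * (L : ℝ) ^ 3) < ((L : ℝ) ^ 3) ^ (-(1 / 5 : ℝ)) := by
  have hL2 : (2 : ℝ) ≤ L := by exact_mod_cast hL
  have hL0 : (0 : ℝ) < (L : ℝ) ^ 3 := by positivity
  have h8 : (8 : ℝ) ≤ (L : ℝ) ^ 3 := by
    have h := pow_le_pow_left₀ (by norm_num : (0 : ℝ) ≤ 2) hL2 3
    norm_num at h
    linarith
  set u := ((L : ℝ) ^ 3) ^ (1 / 5 : ℝ) with hu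
  have hu0 : 0 < u := Real.rpow_pos_of_pos hL0 _
  have hu5 : u ^ (5 : ℕ) = (L : ℝ) ^ 3 := by
    rw [hu, ← Real.rpow_natCast, ← Real.rpow_mul hL0.le]; norm_num
  -- `u ≥ 3/2` since `(3/2)⁵ < 8 ≤ u⁵`
  have hu32 : (3 / 2 : ℝ) ≤ u := by
    by_contra hlt
    push Not at hlt
    have : u ^ (5 : ℕ) < (3 / 2 : ℝ) ^ (5 : ℕ) := pow_lt_pow_left₀ hlt hu0.le (by norm_num)
    rw [hu5] at this
    norm_num at this
    linarith
  have hinv : ((L : ℝ) ^ 3) ^ (-(1 / 5 : ℝ)) = u⁻¹ := by rw [Real.rpow_neg hL0.le, ← hu]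
  rw [hinv, ← hu5]
  have h2 : (1 : ℝ) ≤ Real.sqrt 2 := by
    have h := Real.sqrt_le_sqrt (show (1 : ℝ) ≤ 2 by norm_num)
    rwa [Real.sqrt_one] at h
  have hπ := Real.pi_le_four
  -- `π/(2√2 u⁵) < 1/u ⟺ π u < 2√2 u⁵ ⟸ π < 2√2 u⁴`
  rw [div_lt_iff₀ (by positivity), ← one_div, one_div_mul_eq_div, lt_div_iff₀ hu0]
  have hu4 : (81 / 16 : ℝ) ≤ u ^ 4 := by
    have h := pow_le_pow_left₀ (by norm_num : (0 : ℝ) ≤ 3 / 2) hu32 4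
    norm_num at h
    linarith
  have hu4pos : (0 : ℝ) ≤ u ^ 4 := by positivity
  have h3 : 2 * u ^ 4 ≤ 2 * Real.sqrt 2 * u ^ 4 := by nlinarith
  have h4 : Real.pi < 2 * Real.sqrt 2 * u ^ 4 := by linarith
  calc Real.pi * u < 2 * Real.sqrt 2 * u ^ 4 * u := mul_lt_mul_of_pos_right h4 hu0
    _ = 2 * Real.sqrt 2 * u ^ (5 : ℕ) := by ring

/-- ★★ **Verdict**: for `1/5 ≤ s`, EVERY `L ≥ 2` and EVERY `β ≥ 1`, the witness' per-link angle (= one-site radius) is STRICTLY BELOW the one-site theorem's threshold: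
`T = π·β^{−s}/(2√2·L³) < (L³β)^{−1/5}`.  At the record pair (core `s = 1/5`, threshold exponent `1/5`) the innermost shell is not covered by `oneSite_shell_gain` for any
lattice size, uniformly in `β`. [folklore] -/
theorem witness_radius_lt_threshold {L : ℕ} (hL : 2 ≤ L) {s : ℝ} (hs : 1 / 5 ≤ s) {β : ℝ} (hβ : 1 ≤ β) :
    Real.pi * powScale s β / (2 * Real.sqrt 2 * (L : ℝ) ^ 3) < ((L : ℝ) ^ 3 * β) ^ (-(1 / 5 : ℝ)) := by
  have hL2 : (2 : ℝ) ≤ L := by exact_mod_cast hL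
  have hL0 : (0 : ℝ) < (L : ℝ) ^ 3 := by positivity
  have hβ0 : 0 < β := by linarith
  have hb : 0 < β ^ (-(1 / 5 : ℝ)) := Real.rpow_pos_of_pos hβ0 _
  rw [Real.mul_rpow hL0.le hβ0.le, powScale_eq hβ]
  have hmono : β ^ (-s) ≤ β ^ (-(1 / 5 : ℝ)) := Real.rpow_le_rpow_of_exponent_le hβ (by linarith)
  have hc := axis_const_lt_threshold_const hL
  have hpos : 0 < Real.pi / (2 * Real.sqrt 2 * (L : ℝ) ^ 3) := by positivity
  calc Real.pi * β ^ (-s) / (2 * Real.sqrt 2 * (L : ℝ) ^ 3)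
      = Real.pi / (2 * Real.sqrt 2 * (L : ℝ) ^ 3) * β ^ (-s) := by ring
    _ ≤ Real.pi / (2 * Real.sqrt 2 * (L : ℝ) ^ 3) * β ^ (-(1 / 5 : ℝ)) := mul_le_mul_of_nonneg_left hmono hpos.le
    _ < ((L : ℝ) ^ 3) ^ (-(1 / 5 : ℝ)) * β ^ (-(1 / 5 : ℝ)) := mul_lt_mul_of_pos_right hc hb

/-- … hence so is its one-site zero-mode radius `‖zmCoord 1 (abelianCfg 1 (T,0,0))‖ = |sin T| ≤ T`: the one-site image of the witness lies INSIDE the region where the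
one-site shell-gain theorem demands `f = 0`, for every admissible `t ≥ (L³β)^{−1/5}`. [folklore] -/
theorem witness_oneSite_radius_lt_threshold {L : ℕ} (hL : 2 ≤ L) {s : ℝ} (hs : 1 / 5 ≤ s) {β : ℝ} (hβ : 1 ≤ β) :
    ‖zmCoord 1 (abelianCfg 1 fun k => if k = (0 : Fin 3) then Real.pi * powScale s β / (2 * Real.sqrt 2 * (L : ℝ) ^ 3) else 0)‖ <
      ((L : ℝ) ^ 3 * β) ^ (-(1 / 5 : ℝ)) := by
  haveI : NeZero L := ⟨by omega⟩
  exact (norm_zmCoord_oneSite_image_le (axisAngle_pos (L := L) s β).le).trans_lt (witness_radius_lt_threshold hL hs hβ)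

/-- The record instance `s = 1/5`, `L = 2`: `T < (8β)^{−1/5}` for every `β ≥ 1`. [folklore] -/
theorem witness_radius_lt_threshold_record_two {β : ℝ} (hβ : 1 ≤ β) :
    Real.pi * powScale (1 / 5) β / (2 * Real.sqrt 2 * ((2 : ℕ) : ℝ) ^ 3) < (((2 : ℕ) : ℝ) ^ 3 * β) ^ (-(1 / 5 : ℝ)) :=
  witness_radius_lt_threshold le_rfl le_rfl hβ

/-- Conversely a STRICTLY smaller core exponent clears the threshold eventually: `s < 1/5 ⇒ (L³β)^{−1/5} ≤ T(β)` for `β ≥ β0(L, s)`. [folklore] -/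
theorem threshold_le_witness_radius_eventually {L : ℕ} [NeZero L] {s : ℝ} (hs : s < 1 / 5) :
    ∃ β0 : ℝ, ∀ β : ℝ, β0 ≤ β → ((L : ℝ) ^ 3 * β) ^ (-(1 / 5 : ℝ)) ≤ Real.pi * powScale s β / (2 * Real.sqrt 2 * (L : ℝ) ^ 3) := by
  have hL1 : (0 : ℝ) < L := by exact_mod_cast Nat.pos_of_ne_zero (NeZero.ne L)
  have hL0 : (0 : ℝ) < (L : ℝ) ^ 3 := by positivity
  have hD : 0 < Real.pi / (2 * Real.sqrt 2 * (L : ℝ) ^ 3) := by positivity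
  obtain ⟨β0, h⟩ := R23.mul_powScale_le_eventually (a := 1 / 5) (b := s) hs (((L : ℝ) ^ 3) ^ (-(1 / 5 : ℝ))) hD
  refine ⟨max β0 1, fun β hb => ?_⟩
  have hβ1 : 1 ≤ β := le_trans (le_max_right _ _) hb
  have hβ0' : 0 < β := by linarith
  have h1 := h β (le_trans (le_max_left _ _) hb)
  rw [powScale_eq (p := 1 / 5) hβ1] at h1
  rw [Real.mul_rpow hL0.le hβ0'.le]
  calc ((L : ℝ) ^ 3) ^ (-(1 / 5 : ℝ)) * β ^ (-(1 / 5 : ℝ)) ≤ Real.pi / (2 * Real.sqrt 2 * (L : ℝ) ^ 3) * powScale s β := h1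
    _ = Real.pi * powScale s β / (2 * Real.sqrt 2 * (L : ℝ) ^ 3) := by ring

/-- The β-free form of the equal-exponent comparison: for `β > 0`, `(L³β)^{−a} ≤ κ·β^{−a}/L³ ↔ L³·(L³)^{−a} ≤ κ`; at `a = 1/5`, `κ = π/(2√2) < 2 ≤ (L³)^{4/5}` it fails for
every `L ≥ 2` (`axis_const_lt_threshold_const`). [folklore] -/
theorem threshold_le_iff_const {L : ℕ} [NeZero L] {a κ β : ℝ} (hβ : 0 < β) :
    ((L : ℝ) ^ 3 * β) ^ (-a) ≤ κ * β ^ (-a) / (L : ℝ) ^ 3 ↔ (L : ℝ) ^ 3 * ((L : ℝ) ^ 3) ^ (-a) ≤ κ := by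
  have hL1 : (0 : ℝ) < L := by exact_mod_cast Nat.pos_of_ne_zero (NeZero.ne L)
  have hL0 : (0 : ℝ) < (L : ℝ) ^ 3 := by positivity
  have hb : 0 < β ^ (-a) := Real.rpow_pos_of_pos hβ _
  rw [Real.mul_rpow hL0.le hβ.le, le_div_iff₀ hL0]
  constructor
  · intro h
    have h' : ((L : ℝ) ^ 3 * ((L : ℝ) ^ 3) ^ (-a)) * β ^ (-a) ≤ κ * β ^ (-a) := by linarith
    exact le_of_mul_le_mul_right h' hb
  · intro h
    have h' := mul_le_mul_of_nonneg_right h hb.le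
    linarith

end Threshold

/-! ## §5 Pointwise cell comparison: the stiff-layer exponent -/

section Cells

/-- ★ Generic: `C·β^{−a} ≤ β^{−b}` eventually for EVERY constant `C` iff `b < a`. [folklore] -/
theorem forall_mul_powScale_le_eventually_iff {a b : ℝ} :
    (∀ C : ℝ, ∃ β0 : ℝ, ∀ β : ℝ, β0 ≤ β → C * powScale a β ≤ powScale b β) ↔ b < a := by
  constructor
  · intro h
    by_contra hab
    push Not at hab
    rcases hab.lt_or_eq with hlt | heq
    · exact R23.not_mul_powScale_le_eventually hlt (by norm_num : (0 : ℝ) < 2) 1 (by simpa using h 2)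
    · obtain ⟨β0, hβ⟩ := h 2
      have h1 := hβ β0 le_rfl
      rw [heq] at h1
      linarith [powScale_pos b β0]
  · intro hab C
    obtain ⟨β0, h⟩ := R23.mul_powScale_le_eventually hab C one_pos
    exact ⟨β0, fun β hb => by simpa using h β hb⟩

/-- The two costs of a frozen-Gaussian cell of power-law radius `r = β^{−ρ}` against the stiff layer `|w|² ≤ β^{−q}`, as scales (`β ≥ 1`): IMS `(βr²)^{−1} = β^{−(1−2ρ)}` and
first-order slow–stiff coupling `r·β·β^{−q} = β^{−(ρ+q−1)}`. [folklore] -/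
theorem cell_costs_eq {β : ℝ} (hβ : 1 ≤ β) (ρ q : ℝ) :
    (β * powScale ρ β ^ 2)⁻¹ = powScale (1 - 2 * ρ) β ∧ powScale ρ β * (β * powScale q β) = powScale (ρ + q - 1) β := by
  have hβ0 : 0 < β := by linarith
  simp only [powScale_eq hβ]
  constructor
  · have e1 : (β ^ (-ρ)) ^ 2 = β ^ (-(2 * ρ)) := by
      rw [← Real.rpow_natCast, ← Real.rpow_mul hβ0.le]
      congr 1
      push_cast
      ring
    have e2 : β * β ^ (-(2 * ρ)) = β ^ (1 - 2 * ρ) := by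
      rw [Real.rpow_sub hβ0, Real.rpow_one, Real.rpow_neg hβ0.le, div_eq_mul_inv]
    rw [e1, e2, Real.rpow_neg hβ0.le]
  · have e : β * β ^ (-q) = β ^ (1 - q) := by
      rw [Real.rpow_sub hβ0, Real.rpow_one, Real.rpow_neg hβ0.le, div_eq_mul_inv]
    rw [e, ← Real.rpow_add hβ0]
    congr 1
    ring

/-- ★ **Exponent window of the pointwise cell comparison**: both costs beat the gain `β^{−3s/2}` for SOME power-law cell radius iff `s < (4q − 2)/9`. [folklore] -/
theorem cell_pointwise_exponents_iff {s q : ℝ} :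
    (∃ ρ : ℝ, 3 * s / 2 < 1 - 2 * ρ ∧ 3 * s / 2 < ρ + q - 1) ↔ s < (4 * q - 2) / 9 := by
  constructor
  · rintro ⟨ρ, h1, h2⟩
    linarith
  · intro h
    refine ⟨((1 / 2 - 3 * s / 4) + (1 + 3 * s / 2 - q)) / 2, ?_, ?_⟩ <;> linarith

/-- The same, as eventual statements about the scales: for a power-law radius `β^{−ρ}` the IMS cost beats every multiple of the gain iff `3s/2 < 1 − 2ρ`, and the coupling cost
iff `3s/2 < ρ + q − 1`. [folklore] -/
theorem cell_costs_eventually_iff {s q ρ : ℝ} :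
    ((∀ C : ℝ, ∃ β0 : ℝ, ∀ β : ℝ, β0 ≤ β → C * powScale (1 - 2 * ρ) β ≤ powScale (3 * s / 2) β) ↔ 3 * s / 2 < 1 - 2 * ρ) ∧
      ((∀ C : ℝ, ∃ β0 : ℝ, ∀ β : ℝ, β0 ≤ β → C * powScale (ρ + q - 1) β ≤ powScale (3 * s / 2) β) ↔ 3 * s / 2 < ρ + q - 1) :=
  ⟨forall_mul_powScale_le_eventually_iff, forall_mul_powScale_le_eventually_iff⟩

/-- ★ **Record layers**: on the small-action layer of record (`q = 17/20`, `S < 2β^{−17/20}`) the window is `s < 7/45 < 1/6` — empty against the core condition `s > 1/6`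
(R23 `sample_cell_first_order_fails_of_sixth_lt` / `oneSite` core windows); on the Gaussian layer (`q = 1`) it is `s < 2/9`. [folklore] -/
theorem cell_window_record_layers :
    (4 * (17 / 20 : ℝ) - 2) / 9 = 7 / 45 ∧ (7 / 45 : ℝ) < 1 / 6 ∧ (4 * (1 : ℝ) - 2) / 9 = 2 / 9 := by norm_num

/-- The window meets the core window `s > 1/6` iff the stiff layer is thinner than `β^{−7/8}`: `1/6 < (4q − 2)/9 ↔ 7/8 < q`. [folklore] -/
theorem cell_window_meets_core_iff {q : ℝ} : 1 / 6 < (4 * q - 2) / 9 ↔ 7 / 8 < q := by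
  constructor <;> intro h <;> linarith

/-- At the record core `s = 1/5`: a pointwise cell comparison needs a stiff layer with `q > 19/20` (`1/5 < (4q−2)/9 ↔ 19/20 < q`) — far inside the small-action shell
`q = 17/20`, within `β^{−1/20}` of the Gaussian bulk. [folklore] -/
theorem cell_window_at_record_core_iff {q : ℝ} : 1 / 5 < (4 * q - 2) / 9 ↔ 19 / 20 < q := by
  constructor <;> intro h <;> linarith

end Cells

end Summit.QuantumFields.YangMills.Theorems.TwistedTraceScaling.Negative.R24

end
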